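import Summits.AtomisticToContinuum.HydrodynamicLimit.Theorems.RelayRaceLocalityNearConstantShortTimeHLEntropyToLLN
import Literature.MathematicalPhysics.KineticTheory.HardSphereEulerProofs
import HarnessLib

/-!
# Crux `NearConstantShortTimeHL` (stmt-AtomisticToContinuum-12502), line `means-pin-entropy` — empirical-field bookkeeping for the converse of the engine target

Support file for `meansConverge_of_nearConstantShortTimeHL : NearConstantShortTimeHL → MeansConverge` (registered
sub-goal of the crux). Elementary facts about the three empirical fields of an `m`-particle configuration tested against
a continuous `χ` with `|χ| ≤ C`: continuity in the configuration, the bounds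
`|ρ_w[χ]| ≤ C`, `‖m_w[χ]‖² ≤ C² · m⁻¹∑‖vᵢ‖²`, `|e_w[χ]| ≤ C · m⁻¹∑‖vᵢ‖²/2`, linearity and positivity of the energy
field in `χ`, the coordinate bound `|wₗ − cₗ| ≤ ‖w − c‖` on `ℝ³`, convergence in `ℝ³` from the coordinates, and the
almost-sure invisibility of `Φ₀` (`Φ.flow 0 = id` on the conull good set) for laws `≪` Liouville.
No definitions. [folklore throughout]
-/

noncomputable section

namespace Summit.AtomisticToContinuum.HydrodynamicLimit.Theorems.NearConstantShortTimeHL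

open scoped BigOperators ENNReal Topology
open MeasureTheory Set Filter
open Literature.MathematicalPhysics.KineticTheory Literature.Analysis.FluidPDE

variable {m : ℕ} {χ : T3 → ℝ} {C : ℝ}

/-! ## Continuity of the empirical fields in the configuration -/

/-- The empirical density field of a continuous test function is continuous in the configuration. [folklore] -/
theorem continuous_empiricalDensityField (hχ : Continuous χ) :
    Continuous fun w : Config m (Fin 3) T3 => empiricalDensityField w χ := by
  have h : (fun w : Config m (Fin 3) T3 => empiricalDensityField w χ) =
      fun w => (m : ℝ)⁻¹ * ∑ i, χ (w i).1 := funext fun w => empiricalDensityField_eq_sum w χ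
  rw [h]
  exact continuous_const.mul (continuous_finsetSum _ fun i _ => hχ.comp (continuous_apply i).fst)

/-- The empirical momentum field of a continuous test function is continuous in the configuration. [folklore] -/
theorem continuous_empiricalMomentumField (hχ : Continuous χ) :
    Continuous fun w : Config m (Fin 3) T3 => empiricalMomentumField w χ := by
  have h : (fun w : Config m (Fin 3) T3 => empiricalMomentumField w χ) =
      fun w => (m : ℝ)⁻¹ • ∑ i, χ (w i).1 • (w i).2 := funext fun w => empiricalMomentumField_eq_sum w χ
  rw [h]
  have hsum : Continuous fun w : Config m (Fin 3) T3 => ∑ i, χ (w i).1 • (w i).2 :=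
    continuous_finsetSum _ fun i _ =>
      ((hχ.comp (continuous_apply i).fst).smul ((continuous_apply i).snd) :
        Continuous fun w : Config m (Fin 3) T3 => χ (w i).1 • (w i).2)
  exact hsum.const_smul ((m : ℝ)⁻¹)

/-- The empirical energy field of a continuous test function is continuous in the configuration. [folklore] -/
theorem continuous_empiricalEnergyField (hχ : Continuous χ) :
    Continuous fun w : Config m (Fin 3) T3 => empiricalEnergyField w χ := by
  have h : (fun w : Config m (Fin 3) T3 => empiricalEnergyField w χ) =
      fun w => (m : ℝ)⁻¹ * ∑ i, χ (w i).1 * (‖(w i).2‖ ^ 2 / 2) := funext fun w => empiricalEnergyField_eq_sum w χ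
  rw [h]
  exact continuous_const.mul (continuous_finsetSum _ fun i _ =>
    (hχ.comp (continuous_apply i).fst).mul (((continuous_apply i).snd.norm.pow 2).div_const 2))

/-! ## Bounds -/

/-- `|ρ_w[χ]| ≤ C` for `|χ| ≤ C`, `C ≥ 0`. [folklore] -/
theorem abs_empiricalDensityField_le (hC : ∀ x, |χ x| ≤ C) (hC0 : 0 ≤ C) (w : Config m (Fin 3) T3) :
    |empiricalDensityField w χ| ≤ C := by
  rw [empiricalDensityField_eq_sum]
  rcases Nat.eq_zero_or_pos m with hm | hm
  · subst hm
    simp [hC0]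
  · have hm' : (0 : ℝ) < m := by exact_mod_cast hm
    rw [abs_mul, abs_inv, abs_of_pos hm']
    calc (m : ℝ)⁻¹ * |∑ i, χ (w i).1| ≤ (m : ℝ)⁻¹ * ∑ i, |χ (w i).1| := by
          gcongr
          exact Finset.abs_sum_le_sum_abs _ _
      _ ≤ (m : ℝ)⁻¹ * ∑ _i : Fin m, C := by
          gcongr with i
          exact hC _
      _ = C := by
          rw [Finset.sum_const, Finset.card_univ, Fintype.card_fin, nsmul_eq_mul]
          field_simp

/-- `‖m_w[χ]‖² ≤ C² · m⁻¹ ∑ᵢ ‖vᵢ‖²` for `|χ| ≤ C`, `C ≥ 0` (triangle inequality and Jensen). [folklore] -/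
theorem norm_empiricalMomentumField_sq_le :
    ∀ {m : ℕ} {χ : T3 → ℝ} {C : ℝ}, (∀ x, |χ x| ≤ C) → 0 ≤ C → ∀ w : Config m (Fin 3) T3,
      ‖empiricalMomentumField w χ‖ ^ 2 ≤ C ^ 2 * ((m : ℝ)⁻¹ * ∑ i, ‖(w i).2‖ ^ 2) := by
  intro m χ C hC hC0 w
  rw [empiricalMomentumField_eq_sum]
  rcases Nat.eq_zero_or_pos m with hm | hm
  · subst hm
    simp
  · have hm' : (0 : ℝ) < m := by exact_mod_cast hm
    -- `‖m⁻¹ ∑ χᵢ vᵢ‖ ≤ m⁻¹ ∑ C ‖vᵢ‖`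
    have h1 : ‖(m : ℝ)⁻¹ • ∑ i, χ (w i).1 • (w i).2‖ ≤ (m : ℝ)⁻¹ * ∑ i, C * ‖(w i).2‖ := by
      rw [norm_smul, Real.norm_eq_abs, abs_inv, abs_of_pos hm']
      gcongr
      calc ‖∑ i, χ (w i).1 • (w i).2‖ ≤ ∑ i, ‖χ (w i).1 • (w i).2‖ := norm_sum_le _ _
        _ ≤ ∑ i, C * ‖(w i).2‖ := Finset.sum_le_sum fun i _ => by
            rw [norm_smul, Real.norm_eq_abs]
            exact mul_le_mul_of_nonneg_right (hC _) (norm_nonneg _)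
    have h0 : 0 ≤ (m : ℝ)⁻¹ * ∑ i, C * ‖(w i).2‖ := by positivity
    -- Jensen: `(∑ aᵢ)² ≤ m ∑ aᵢ²`
    have h2 : (∑ i, ‖(w i).2‖) ^ 2 ≤ m * ∑ i, ‖(w i).2‖ ^ 2 := by
      have h := sq_sum_le_card_mul_sum_sq (s := (Finset.univ : Finset (Fin m))) (f := fun i => ‖(w i).2‖)
      simpa [Finset.card_univ, Fintype.card_fin] using h
    calc ‖(m : ℝ)⁻¹ • ∑ i, χ (w i).1 • (w i).2‖ ^ 2 ≤ ((m : ℝ)⁻¹ * ∑ i, C * ‖(w i).2‖) ^ 2 :=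
          pow_le_pow_left₀ (norm_nonneg _) h1 2
      _ = C ^ 2 * ((m : ℝ)⁻¹ ^ 2 * (∑ i, ‖(w i).2‖) ^ 2) := by rw [← Finset.mul_sum]; ring
      _ ≤ C ^ 2 * ((m : ℝ)⁻¹ ^ 2 * (m * ∑ i, ‖(w i).2‖ ^ 2)) := by gcongr
      _ = C ^ 2 * ((m : ℝ)⁻¹ * ∑ i, ‖(w i).2‖ ^ 2) := by field_simp

/-- `|e_w[χ]| ≤ C · m⁻¹ ∑ᵢ ‖vᵢ‖²/2` for `|χ| ≤ C`. [folklore] -/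
theorem abs_empiricalEnergyField_le (hC : ∀ x, |χ x| ≤ C) (w : Config m (Fin 3) T3) :
    |empiricalEnergyField w χ| ≤ C * ((m : ℝ)⁻¹ * ∑ i, ‖(w i).2‖ ^ 2 / 2) := by
  rw [empiricalEnergyField_eq_sum, abs_mul, abs_inv, Nat.abs_cast]
  calc (m : ℝ)⁻¹ * |∑ i, χ (w i).1 * (‖(w i).2‖ ^ 2 / 2)| ≤ (m : ℝ)⁻¹ * ∑ i, |χ (w i).1 * (‖(w i).2‖ ^ 2 / 2)| := by
        gcongr
        exact Finset.abs_sum_le_sum_abs _ _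
    _ ≤ (m : ℝ)⁻¹ * ∑ i, C * (‖(w i).2‖ ^ 2 / 2) := by
        gcongr with i
        rw [abs_mul, abs_of_nonneg (by positivity : (0 : ℝ) ≤ ‖(w i).2‖ ^ 2 / 2)]
        exact mul_le_mul_of_nonneg_right (hC _) (by positivity)
    _ = C * ((m : ℝ)⁻¹ * ∑ i, ‖(w i).2‖ ^ 2 / 2) := by
        rw [Finset.mul_sum, Finset.mul_sum, Finset.mul_sum]
        exact Finset.sum_congr rfl fun i _ => by ring

/-! ## The energy field is linear and monotone in the test function -/

/-- Additivity of the empirical energy field in the test function. [folklore] -/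
theorem empiricalEnergyField_add (w : Config m (Fin 3) T3) (χ₁ χ₂ : T3 → ℝ) :
    empiricalEnergyField w (fun x => χ₁ x + χ₂ x) = empiricalEnergyField w χ₁ + empiricalEnergyField w χ₂ := by
  simp only [empiricalEnergyField_eq_sum]
  rw [← mul_add, ← Finset.sum_add_distrib]
  congr 1
  exact Finset.sum_congr rfl fun i _ => by ring

/-- Homogeneity of the empirical energy field in the test function. [folklore] -/
theorem empiricalEnergyField_const_mul (w : Config m (Fin 3) T3) (c : ℝ) (χ : T3 → ℝ) :
    empiricalEnergyField w (fun x => c * χ x) = c * empiricalEnergyField w χ := by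
  simp only [empiricalEnergyField_eq_sum]
  rw [Finset.mul_sum, Finset.mul_sum, Finset.mul_sum]
  exact Finset.sum_congr rfl fun i _ => by ring

/-- The empirical energy field of a nonnegative test function is nonnegative. [folklore] -/
theorem empiricalEnergyField_nonneg {χ : T3 → ℝ} (hχ0 : ∀ x, 0 ≤ χ x) (w : Config m (Fin 3) T3) :
    0 ≤ empiricalEnergyField w χ := by
  rw [empiricalEnergyField_eq_sum]
  exact mul_nonneg (inv_nonneg.2 (Nat.cast_nonneg m)) (Finset.sum_nonneg fun i _ => mul_nonneg (hχ0 _) (by positivity))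

/-- The total empirical kinetic energy (test function `1`) is `m⁻¹ ∑ᵢ ‖vᵢ‖²/2`. [folklore] -/
theorem empiricalEnergyField_one_eq_avg (w : Config m (Fin 3) T3) :
    empiricalEnergyField w (fun _ => 1) = (m : ℝ)⁻¹ * ∑ i, ‖(w i).2‖ ^ 2 / 2 := by
  rw [empiricalEnergyField_eq_sum]
  congr 1
  exact Finset.sum_congr rfl fun i _ => by ring

/-! ## Coordinates on `ℝ³` -/

/-- A coordinate difference is bounded by the norm of the difference in `ℝ³`. [folklore] -/
theorem abs_apply_sub_le_norm (w c : V3) (l : Fin 3) : |w l - c l| ≤ ‖w - c‖ := by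
  have h : |(w - c) l| ≤ ‖w - c‖ := by
    have := PiLp.norm_apply_le (w - c) l
    rwa [Real.norm_eq_abs] at this
  simpa using h

/-- Convergence in `ℝ³` from convergence of the three coordinates. [folklore] -/
theorem tendsto_V3_of_apply {f : ℕ → V3} {x : V3} (h : ∀ l, Tendsto (fun N => f N l) atTop (𝓝 (x l))) :
    Tendsto f atTop (𝓝 x) := by
  have h' : Tendsto (fun N => (EuclideanSpace.equiv (Fin 3) ℝ) (f N)) atTop (𝓝 ((EuclideanSpace.equiv (Fin 3) ℝ) x)) :=
    tendsto_pi_nhds.2 fun l => by simpa using h l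
  have h'' := ((EuclideanSpace.equiv (Fin 3) ℝ).symm.continuous.tendsto _).comp h'
  simpa [Function.comp_def] using h''

/-! ## The time-`0` flow map is invisible almost surely -/

/-- For a law `P ≪ Liouville`, events tested on `Φ₀ z` and on `z` have the same probability (`Φ.flow 0 = id` on the conull
good set). [folklore] -/
theorem measure_setOf_flow_zero {ε : ℝ} {N : ℕ} (Φ : HardSphereFlow (Torus.geometry (Fin 3)) ε N)
    {P : Measure (Config N (Fin 3) T3)} (hP : P ≪ liouville (Torus.geometry (Fin 3)) N ε)
    (p : Config N (Fin 3) T3 → Prop) : P {z | p (Φ.flow 0 z)} = P {z | p z} := by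
  refine measure_congr ?_
  filter_upwards [hP.ae_le Φ.ae_mem_good] with z hz
  simp only [eq_iff_iff]
  show p (Φ.flow 0 z) ↔ p z
  rw [Φ.flow_zero z hz]

end Summit.AtomisticToContinuum.HydrodynamicLimit.Theorems.NearConstantShortTimeHL

end
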